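import Literature.NumberTheory.Rogawski1990.ArchEndoscopicDeltaSideContinuous   -- ★ LH3-p04 (g2) (W1-cont): the Cayley-frame family `γH z`, `map_evalC_fst∕snd_cayleyTorus`, `isArchNormPair_cayleyTorus_relabel`
import Literature.NumberTheory.Rogawski1990.ArchHeckeValueRealShape             -- ★ LH3-p04 (g2) (μ-guard-∞): `exists_odd_archHeckeValue_single_eq_zpow`; brings ★ `archHeckeValue_eq_prod_single`
import Literature.NumberTheory.Rogawski1990.ArchExplicitTransferFactorRegular   -- ★ `isUnit_archGammaTwo`
import HarnessLib

/-!
# Rogawski's explicit factor `Δ″_∞` ON THE CAYLEY TORUS FAMILY is a LAURENT POLYNOMIAL in the circle coordinates: `κ_w` per relabelled partner (any signature), `τ·D_{G∕H,∞}`, and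
# `Δ″(γ_H(z), t(z∘ρ)) = K_ρ · Π_w [−(z_{w,0}z_{w,2})^{k_w} (z_{w,1}−z_{w,0})(z_{w,1}−z_{w,2}) ∕ z_{w,1}]` under the μ-guard (Rogawski 1990 §8.2 p. 119, §4.9 p. 55, §14.6 p. 242)

Topic `NumberTheory/Rogawski1990`; namespace `Literature.NumberTheory.Rogawski1990`.  THEOREMS ONLY (no `def`, no instance, no notation, no axiom, no named fact, no `sorry`).
Cell `pub/hodgecm-mathlib`, line LH3 (closer stub `stub_N9`, crux H413 = `stmt-HodgeConjecture-24833`), organ **(Δ-def-explicit) + (κ-TABLE)** of the (D-i-def)∕(M1)(M2) chain (LH3-plan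
(g2) DEALER WORDS #3 ∕ 05:2xZ board; author LH3-p04 (g2), 2026-09-02).  Consumer: the (D-i-def) head «the Δ″-side is `C^∞` in the angles across the `G`-walls» (definite frame: one class,
★ `contDiff_integral_comp_conj_archDiagTorus_angles_of_compactSpace`), and (I₁-Δ)∕(M2) at indefinite places (the `Δ″`-FACTOR of every relabelled partner is smooth everywhere — what
jumps there is the class bookkeeping and the orbital factor, not `Δ″`).

THE MATHEMATICS.  On the diagonal frame `G′_∞ = U(diag α)(L⁺ ⊗ ℝ)` (any signature, `α_i ≠ 0` hermitian), along the Cayley-frame family `γ_H(z)` (★ `ArchEndoscopicDeltaSideContinuous`; 2-block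
eigenvalues `z_{w,0}, z_{w,2}`, 1-block `z_{w,1}`) and its relabelled partners `t(z∘ρ)` (`ρ : W → S₃`), with `q_w := (z_{w,1} − z_{w,0})(z_{w,1} − z_{w,2}) = σ_w(χ_g(γ₂))` and
`A_w := σ_w(−χ_g(γ₂)∕det g) = −q_w∕(z_{w,0}z_{w,2})` (`τ`'s argument):
* (κ-TABLE) the eigenline polynomial is `P_w = χ_{g_w}(t(z∘ρ)_w) = diag(i ↦ [ρ_w i = 1]·q_w)`, so `κ_w(γ_H(z), t(z∘ρ)) = sgn(re σ_w(α_{ρ_w⁻¹(1)}))·η_w` when `q_w ≠ 0` and `= 0` at the `G`-walls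
  `q_w = 0` — CONSTANT in `z` off the walls, for EVERY relabelling and EVERY signature (no `κ`-jump along a fixed partner; cf. ★ `archKappaAt_archSingularCurve_relabel_eq_of_ne_zero` on curves);
* `D_{G∕H,∞}(γ_H(z)) = Π_w ‖q_w‖ = Π_w ‖A_w‖`; `τ = μ_∞(γ₂)·μ_∞(A)⁻¹` with `μ_∞ = Π_w F_w` on units (★ `archHeckeValue_eq_prod_single`) and `μ_∞ = 0` at non-units (so `Δ″ = 0` AT the walls);
* hence **`Δ″(γ_H(z), t(z∘ρ)) = K_ρ · τ(γ_H(z)) · D_{G∕H,∞}(γ_H(z))`** for ALL `z` with the constant `K_ρ := Π_w sgn(re σ_w(α_{ρ_w⁻¹(1)}))·η_w ∈ {0, ±1}`;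
* under the μ-GUARD (★ `exists_odd_archHeckeValue_single_eq_zpow`: `F_w = (·∕|·|)^{2k_w+1}`), unit-circle algebra (`z̄ = z⁻¹`, `Ā_w = −q_w∕z_{w,1}²`, `‖A‖² = AĀ`) gives per place
  `z₁^{2k+1}·(A∕‖A‖)^{−(2k+1)}·‖A‖ = −(z₀z₂)^k q∕z₁` [Rogawski p. 119: «`τ(γ)|A₁A₂| = μ(e^{iφ})e^{2i(φ−θ)t}(e^{i(φ−θ−ψ)} − 1)(1 − e^{i(φ−θ+ψ)})` … smooth»], so
  **`τ·D = Π_w [−(z_{w,0}z_{w,2})^{k_w}·q_w∕z_{w,1}]`** and **`Δ″(γ_H(z), t(z∘ρ)) = K_ρ · Π_w [−(z_{w,0}z_{w,2})^{k_w}·q_w∕z_{w,1}]`** for ALL `z` — a Laurent monomial times `q`, visibly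
  `C^∞` (indeed real-analytic) in the angles through every wall.

WHAT IS PROVED (all over the equality binder `hγH` of ★ (W1-cont)).  §1 per-place readings at `γ_H(z)` (private: matrix of the 2-block, `σ_w(γ₂) = z₁`, `σ_w(χ_g(γ₂)) = q_w`, `σ_w(det g) = z₀z₂`,
`σ_w(A)`); §2 **(κ-TABLE)** `archEigenlineProjector_cayleyTorus_relabel`, `archKappaAt_cayleyTorus_relabel_eq_of_ne_zero`, `archKappaAt_cayleyTorus_relabel_eq_zero`; §3
`archWeylRatio_cayleyTorus`, **`archExplicitDelta_cayleyTorus_relabel_eq_mul`** (`Δ″ = K_ρ·τ·D`, all `z`); §4 under `hμω`: **`exists_archTau_mul_archWeylRatio_cayleyTorus_eq`** and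
**`exists_archExplicitDelta_cayleyTorus_relabel_eq_prod`** (the Laurent form with ONE `k : W → ℤ` for all `z`, `ρ`).
HONEST LABEL: HC_CM is proved only modulo the 7 printed citations (2 remaining: hLiu418 = stmt-HodgeConjecture-24832, h413 = stmt-HodgeConjecture-24833) until rung 0 closes; (Δ-def-explicit)
is kit for organ (M1)∕(M2) of the LH3 direct road and pays nothing by itself.

## References
* [Rogawski1990] J. D. Rogawski, *Automorphic Representations of Unitary Groups in Three Variables*, Ann. of Math. Stud. 123 (1990), §8.2 p. 119 (`τ(γ)|A₁A₂|` explicit and smooth), §4.9 p. 55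
  (`τ`, `D_{G∕H}`), §14.6 p. 242 (`κ`).
* [LanglandsShelstad1987] R. P. Langlands, D. Shelstad, *On the definition of transfer factors*, Math. Ann. 278 (1987), §2, Lemma 4.1.A.
-/

set_option autoImplicit false

noncomputable section

open NumberField NumberField.InfinitePlace Polynomial Complex Equiv
open scoped MatrixGroups ComplexConjugate

namespace Literature.NumberTheory.Rogawski1990

open Literature.NumberTheory.Automorphic Literature.NumberTheory.GaloisRepresentations

/-! ## §0 Scalar algebra (private) -/

/-- `sgn(|q|²·r) = sgn r` for `q ≠ 0`. [folklore] -/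
private theorem sign_normSq_mul'' {q : ℂ} (hq : q ≠ 0) (r : ℝ) : SignType.sign (Complex.normSq q * r) = SignType.sign r := by
  rw [sign_mul, (sign_pos (Complex.normSq_pos.mpr hq) : SignType.sign (Complex.normSq q) = 1), one_mul]

/-- The scalar identity behind `χ_g(d) = (d − a)(d − b)` on the three diagonal slots (`tr g = a + b`, `det g = ab` read from the Cayley matrix `½[[a+b, a−b],[a−b, a+b]]`). [folklore] -/
private theorem charpoly_slot_eq' (A U B : ℂ) (k : Fin 3) :
    ![A, U, B] k * ![A, U, B] k - ((A + B) / 2 + (A + B) / 2) * ![A, U, B] k + ((A + B) / 2 * ((A + B) / 2) - (A - B) / 2 * ((A - B) / 2)) =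
      if k = 1 then (U - A) * (U - B) else 0 := by
  fin_cases k <;> simp <;> ring

/-- Pure `zpow` bookkeeping: for non-zero `u v q n` with `n² = q²(u²v)⁻¹`, `u^{2k+1}·((−(q v⁻¹)∕n)^{2k+1})⁻¹·n = −v^k q∕u`. [folklore] -/
private theorem zpow_bookkeeping (u v q n : ℂ) (hu : u ≠ 0) (hv : v ≠ 0) (hq : q ≠ 0) (hn : n ≠ 0)
    (R : n ^ (2 : ℤ) = q ^ (2 : ℤ) * (u ^ (2 : ℤ) * v)⁻¹) (k : ℤ) :
    u ^ (2 * k + 1) * (((-(q * v⁻¹) / n) ^ (2 * k + 1))⁻¹ * n) = -(v ^ k * q / u) := by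
  have hm : Odd (2 * k + 1) := ⟨k, rfl⟩
  have e1 : ((-(q * v⁻¹) / n) ^ (2 * k + 1))⁻¹ * n = -(q ^ (-(2 * k + 1)) * v ^ (2 * k + 1) * (n ^ (2 * k + 1) * n)) := by
    have h : (-(q * v⁻¹) / n) = (-1) * q * v⁻¹ * n⁻¹ := by rw [div_eq_mul_inv]; ring
    rw [h, ← inv_zpow, mul_inv, mul_inv, mul_inv, inv_inv, inv_inv, inv_neg_one, mul_zpow, mul_zpow, mul_zpow, hm.neg_one_zpow,
      inv_zpow' q]
    ring
  have e2 : n ^ (2 * k + 1) * n = q ^ (2 * (k + 1)) * u ^ (-(2 * (k + 1))) * v ^ (-(k + 1)) := by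
    rw [← zpow_add_one₀ hn, show (2 * k + 1 + 1 : ℤ) = 2 * (k + 1) by ring, zpow_mul, R, mul_zpow, inv_zpow, mul_zpow, ← zpow_mul, ← zpow_mul, mul_inv,
      ← zpow_neg, ← zpow_neg]
    ring
  rw [e1, e2]
  have cu : u ^ (2 * k + 1) * u ^ (-(2 * (k + 1))) = u⁻¹ := by rw [← zpow_add₀ hu, show (2 * k + 1 + -(2 * (k + 1)) : ℤ) = -1 by ring, zpow_neg_one]
  have cq : q ^ (-(2 * k + 1)) * q ^ (2 * (k + 1)) = q := by rw [← zpow_add₀ hq, show (-(2 * k + 1) + 2 * (k + 1) : ℤ) = 1 by ring, zpow_one]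
  have cv : v ^ (2 * k + 1) * v ^ (-(k + 1)) = v ^ k := by rw [← zpow_add₀ hv]; congr 1; ring
  calc u ^ (2 * k + 1) * -(q ^ (-(2 * k + 1)) * v ^ (2 * k + 1) * (q ^ (2 * (k + 1)) * u ^ (-(2 * (k + 1))) * v ^ (-(k + 1))))
      = -((u ^ (2 * k + 1) * u ^ (-(2 * (k + 1)))) * (q ^ (-(2 * k + 1)) * q ^ (2 * (k + 1))) * (v ^ (2 * k + 1) * v ^ (-(k + 1)))) := by ring
    _ = -(u⁻¹ * q * v ^ k) := by rw [cu, cq, cv]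
    _ = -(v ^ k * q / u) := by rw [div_eq_mul_inv]; ring

/-- **Rogawski's p. 119 computation, per place**: for `a, u, b` on the unit circle and `m = 2k+1`, with `q = (u − a)(u − b)`, `A = −q∕(ab)`:
`(u∕‖u‖)^m · ((A∕‖A‖)^m)⁻¹ · ‖q‖ = −(ab)^k·q∕u` (both sides `0` when `q = 0`). [cite: Rogawski1990, §8.2 p. 119] -/
private theorem circle_key (a u b : ℂ) (ha : ‖a‖ = 1) (hu : ‖u‖ = 1) (hb : ‖b‖ = 1) (k : ℤ) :
    (u / (‖u‖ : ℂ)) ^ (2 * k + 1) *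
      (((-(((u - a) * (u - b)) * (a * b)⁻¹)) / (‖-(((u - a) * (u - b)) * (a * b)⁻¹)‖ : ℂ)) ^ (2 * k + 1))⁻¹ * (‖(u - a) * (u - b)‖ : ℂ) =
      -((a * b) ^ k * ((u - a) * (u - b)) / u) := by
  rw [mul_assoc]
  have ha0 : a ≠ 0 := fun h => by simp [h] at ha
  have hu0 : u ≠ 0 := fun h => by simp [h] at hu
  have hb0 : b ≠ 0 := fun h => by simp [h] at hb
  set q : ℂ := (u - a) * (u - b) with hq
  rw [hu, Complex.ofReal_one, div_one]
  by_cases hq0 : q = 0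
  · simp [hq0]
  have hab : a * b ≠ 0 := mul_ne_zero ha0 hb0
  have hnab : ‖a * b‖ = 1 := by rw [norm_mul, ha, hb, mul_one]
  have hnA : (‖-(q * (a * b)⁻¹)‖ : ℂ) = (‖q‖ : ℂ) := by
    rw [norm_neg, norm_mul, norm_inv, hnab, inv_one, mul_one]
  have hca : conj a = a⁻¹ := (Complex.inv_eq_conj ha).symm
  have hcu : conj u = u⁻¹ := (Complex.inv_eq_conj hu).symm
  have hcb : conj b = b⁻¹ := (Complex.inv_eq_conj hb).symm
  have hnq0 : (‖q‖ : ℂ) ≠ 0 := Complex.ofReal_ne_zero.2 (norm_ne_zero_iff.2 hq0)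
  have R : ((‖q‖ : ℂ)) ^ (2 : ℤ) = q ^ (2 : ℤ) * (u ^ (2 : ℤ) * (a * b))⁻¹ := by
    have h1 : ((‖q‖ : ℂ)) ^ (2 : ℤ) = q * conj q := by rw [zpow_two, Complex.mul_conj, Complex.normSq_eq_norm_sq]; push_cast; ring
    rw [h1, hq, map_mul, map_sub, map_sub, hca, hcu, hcb, zpow_two, zpow_two]
    field_simp
    ring
  rw [hnA]
  exact zpow_bookkeeping u (a * b) q (‖q‖ : ℂ) hu0 hab hq0 hnq0 R k

section CayleyTorus

variable (L : Type) [Field L] [NumberField L] [IsCMField L] (α : Fin 3 → L)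
  (γH : ({w : InfinitePlace L // IsComplex w} → Fin 3 → Circle) →
    ↥(UnitaryGroup.arch (↥(maximalRealSubfield L)) L (IsCMField.complexConj L) 2
        (Matrix.of fun i j : Fin 2 => if i.val + j.val + 1 = 2 then (1 : L) else 0)) ×
      ↥(UnitaryGroup.arch (↥(maximalRealSubfield L)) L (IsCMField.complexConj L) 1
        (Matrix.of fun i j : Fin 1 => if i.val + j.val + 1 = 1 then (1 : L) else 0)))
  (hγH : γH = fun z =>
    ((UnitaryGroup.archPiEquivCM 2 L (Matrix.of fun i j : Fin 2 => if i.val + j.val + 1 = 2 then (1 : L) else 0)).symm fun w =>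
        ⟨Matrix.GeneralLinearGroup.mkOfDetNeZero !![(1 : ℂ), 1; 1, -1] UnitaryGroup.det_cayleyTwo_ne_zero *
            UnitaryGroup.circleDiagonal 2 ![z w 0, z w 2] *
          (Matrix.GeneralLinearGroup.mkOfDetNeZero !![(1 : ℂ), 1; 1, -1] UnitaryGroup.det_cayleyTwo_ne_zero)⁻¹,
          UnitaryGroup.cayley_conj_circleDiagonal_mem_archLocal L w _⟩,
      (UnitaryGroup.archPiEquivCM 1 L (Matrix.of fun i j : Fin 1 => if i.val + j.val + 1 = 1 then (1 : L) else 0)).symm fun w =>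
        ⟨UnitaryGroup.circleDiagonal 1 ![z w 1], UnitaryGroup.circleDiagonal_mem_archLocal_antidiagOne L w _⟩))
  (μ : HeckeCharacter L)

/-! ## §1 Per-place readings at `γ_H(z)` -/

include hγH in
/-- The `w`-matrix of the 2-block of `γ_H(z)`: `½·[[a+b, a−b],[a−b, a+b]]`, `a = z_{w,0}`, `b = z_{w,2}` (★ `map_evalC_fst_cayleyTorus` ∘ ★ `coe_cayley_conj_circleDiagonal`).
[cite: Rogawski1990, §8.2 p. 122] -/
private theorem coe_map_evalC_fst_cayleyTorus (z : {w : InfinitePlace L // IsComplex w} → Fin 3 → Circle) (w : {w : InfinitePlace L // IsComplex w}) :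
    ((((γH z).1 : ↥(UnitaryGroup.arch (↥(maximalRealSubfield L)) L (IsCMField.complexConj L) 2
        (Matrix.of fun i j : Fin 2 => if i.val + j.val + 1 = 2 then (1 : L) else 0))) : GL (Fin 2) (mixedEmbedding.mixedSpace L)) :
          Matrix (Fin 2) (Fin 2) (mixedEmbedding.mixedSpace L)).map (UnitaryGroup.evalC L w) =
      !![((z w 0 : ℂ) + (z w 2 : ℂ)) / 2, ((z w 0 : ℂ) - (z w 2 : ℂ)) / 2; ((z w 0 : ℂ) - (z w 2 : ℂ)) / 2, ((z w 0 : ℂ) + (z w 2 : ℂ)) / 2] := by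
  have h := congrArg (fun g : GL (Fin 2) ℂ => (g : Matrix (Fin 2) (Fin 2) ℂ)) (map_evalC_fst_cayleyTorus L γH hγH z w)
  rw [UnitaryGroup.coe_cayley_conj_circleDiagonal] at h
  simp only [Matrix.cons_val_zero, Matrix.cons_val_one] at h
  exact (Eq.trans rfl h : _)

include hγH in
/-- `σ_w(γ₂) = z_{w,1}` at `γ_H(z)`. [cite: Rogawski1990, §4.9 p. 55] -/
private theorem evalC_archGammaTwo_cayleyTorus (z : {w : InfinitePlace L // IsComplex w} → Fin 3 → Circle) (w : {w : InfinitePlace L // IsComplex w}) :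
    UnitaryGroup.evalC L w (archGammaTwo L (γH z)) = z w 1 := by
  have h := congrArg (fun g : GL (Fin 1) ℂ => (g : Matrix (Fin 1) (Fin 1) ℂ) 0 0) (map_evalC_snd_cayleyTorus L γH hγH z w)
  simp only [UnitaryGroup.coe_circleDiagonal, Matrix.diagonal_apply_eq, Matrix.cons_val_zero] at h
  exact h

include hγH in
/-- `σ_w(χ_g(γ₂)) = (z_{w,1} − z_{w,0})(z_{w,1} − z_{w,2}) = q_w` at `γ_H(z)`. [cite: Rogawski1990, §4.9 p. 55; §8.2 p. 123] -/
private theorem evalC_eval_archCharpolyTwo_cayleyTorus (z : {w : InfinitePlace L // IsComplex w} → Fin 3 → Circle) (w : {w : InfinitePlace L // IsComplex w}) :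
    UnitaryGroup.evalC L w ((archCharpolyTwo L (γH z)).eval (archGammaTwo L (γH z))) = ((z w 1 : ℂ) - (z w 0 : ℂ)) * ((z w 1 : ℂ) - (z w 2 : ℂ)) := by
  rw [← Polynomial.eval₂_at_apply, ← Polynomial.eval_map]
  unfold archCharpolyTwo
  rw [← Matrix.charpoly_map, coe_map_evalC_fst_cayleyTorus L γH hγH z w, evalC_archGammaTwo_cayleyTorus L γH hγH z w, Matrix.charpoly_fin_two]
  simp only [Matrix.trace_fin_two_of, Matrix.det_fin_two_of, eval_add, eval_sub, eval_mul, eval_pow, eval_X, eval_C]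
  ring

include hγH in
/-- `σ_w(det g) = z_{w,0} z_{w,2}` at `γ_H(z)`. [cite: Rogawski1990, §8.2 p. 122] -/
private theorem evalC_det_fst_cayleyTorus (z : {w : InfinitePlace L // IsComplex w} → Fin 3 → Circle) (w : {w : InfinitePlace L // IsComplex w}) :
    UnitaryGroup.evalC L w
        ((((γH z).1 : ↥(UnitaryGroup.arch (↥(maximalRealSubfield L)) L (IsCMField.complexConj L) 2
          (Matrix.of fun i j : Fin 2 => if i.val + j.val + 1 = 2 then (1 : L) else 0))) : GL (Fin 2) (mixedEmbedding.mixedSpace L)) :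
            Matrix (Fin 2) (Fin 2) (mixedEmbedding.mixedSpace L)).det = (z w 0 : ℂ) * (z w 2 : ℂ) := by
  rw [RingHom.map_det, RingHom.mapMatrix_apply, coe_map_evalC_fst_cayleyTorus L γH hγH z w, Matrix.det_fin_two_of]
  ring

include hγH in
/-- `σ_w(A) = −q_w · (z_{w,0}z_{w,2})⁻¹` for `τ`'s argument `A = −χ_g(γ₂)·det g⁻¹` at `γ_H(z)`. [cite: Rogawski1990, §4.9 p. 55; §8.2 p. 123] -/
private theorem evalC_archTauArg_cayleyTorus (z : {w : InfinitePlace L // IsComplex w} → Fin 3 → Circle) (w : {w : InfinitePlace L // IsComplex w}) :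
    UnitaryGroup.evalC L w (archTauArg L (γH z)) =
      -((((z w 1 : ℂ) - (z w 0 : ℂ)) * ((z w 1 : ℂ) - (z w 2 : ℂ))) * ((z w 0 : ℂ) * (z w 2 : ℂ))⁻¹) := by
  unfold archTauArg
  rw [map_mul, map_neg, evalC_eval_archCharpolyTwo_cayleyTorus L γH hγH z w, neg_mul]
  congr 2
  have hdet : (((((γH z).1 : ↥(UnitaryGroup.arch (↥(maximalRealSubfield L)) L (IsCMField.complexConj L) 2
          (Matrix.of fun i j : Fin 2 => if i.val + j.val + 1 = 2 then (1 : L) else 0))) : GL (Fin 2) (mixedEmbedding.mixedSpace L))⁻¹ :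
            GL (Fin 2) (mixedEmbedding.mixedSpace L)) : Matrix (Fin 2) (Fin 2) (mixedEmbedding.mixedSpace L)).det *
      ((((γH z).1 : ↥(UnitaryGroup.arch (↥(maximalRealSubfield L)) L (IsCMField.complexConj L) 2
          (Matrix.of fun i j : Fin 2 => if i.val + j.val + 1 = 2 then (1 : L) else 0))) : GL (Fin 2) (mixedEmbedding.mixedSpace L)) :
            Matrix (Fin 2) (Fin 2) (mixedEmbedding.mixedSpace L)).det = 1 := by
    rw [← Matrix.det_mul, ← Units.val_mul, inv_mul_cancel, Units.val_one, Matrix.det_one]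
  have h1 := congrArg (UnitaryGroup.evalC L w) hdet
  rw [map_mul, map_one, evalC_det_fst_cayleyTorus L γH hγH z w] at h1
  exact eq_inv_of_mul_eq_one_left h1

/-! ## §2 (κ-TABLE): the eigenline polynomial and `κ_w` of every relabelled partner -/

include hγH in
/-- **THE EIGENLINE POLYNOMIAL OF THE RELABELLED PARTNER**: `P_w(γ_H(z), t(z∘ρ)) = χ_{g_w}(t(z∘ρ)_w) = diag(i ↦ [ρ_w i = 1]·q_w)`, `q_w = (z₁ − z₀)(z₁ − z₂)` — the `u`-eigenline
sits in slot `ρ_w⁻¹(1)` and the polynomial VANISHES IDENTICALLY exactly at the `G`-walls `q_w = 0`. [cite: Rogawski1990, §14.6 p. 242; §4.9 p. 55] -/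
theorem archEigenlineProjector_cayleyTorus_relabel (z : {w : InfinitePlace L // IsComplex w} → Fin 3 → Circle)
    (ρ : {w : InfinitePlace L // IsComplex w} → Perm (Fin 3)) (w : {w : InfinitePlace L // IsComplex w}) :
    archEigenlineProjector L (Matrix.diagonal α) (γH z) w (UnitaryGroup.archDiagTorus L 3 α fun w => z w ∘ ρ w) =
      Matrix.diagonal fun i => if ρ w i = 1 then ((z w 1 : ℂ) - (z w 0 : ℂ)) * ((z w 1 : ℂ) - (z w 2 : ℂ)) else 0 := by
  set A : ℂ := (z w 0 : ℂ) with hA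
  set B : ℂ := (z w 2 : ℂ) with hB
  set U : ℂ := (z w 1 : ℂ) with hU
  have hG : ((((UnitaryGroup.archDiagTorus L 3 α fun w => z w ∘ ρ w :
        ↥(UnitaryGroup.arch (↥(maximalRealSubfield L)) L (IsCMField.complexConj L) 3 (Matrix.diagonal α))) : GL (Fin 3) (mixedEmbedding.mixedSpace L)) :
          Matrix (Fin 3) (Fin 3) (mixedEmbedding.mixedSpace L)).map (UnitaryGroup.evalC L w)) =
      Matrix.diagonal fun i => ![A, U, B] (ρ w i) := by
    have h := congrArg (fun g : GL (Fin 3) ℂ => (g : Matrix (Fin 3) (Fin 3) ℂ)) (UnitaryGroup.archAt_archDiagTorus L 3 α (fun w => z w ∘ ρ w) w)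
    rw [UnitaryGroup.coe_circleDiagonal] at h
    refine (Eq.trans rfl h : _).trans ?_
    congr 1
    funext i
    simp only [Function.comp_apply]
    generalize ρ w i = k
    fin_cases k <;> rfl
  have hH := coe_map_evalC_fst_cayleyTorus L γH hγH z w
  rw [← hA, ← hB] at hH
  unfold archEigenlineProjector
  simp only []
  rw [hG, hH, Matrix.trace_fin_two_of, Matrix.det_fin_two_of, Matrix.diagonal_mul_diagonal]
  ext i j
  simp only [Matrix.sub_apply, Matrix.add_apply, Matrix.smul_apply, Matrix.diagonal_apply, Matrix.one_apply, smul_eq_mul]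
  by_cases hij : i = j
  · subst hij
    simp only [if_true, mul_one]
    exact charpoly_slot_eq' A U B (ρ w i)
  · simp [hij]

include hγH in
/-- **(κ-TABLE) OFF THE WALLS: `κ_w(γ_H(z), t(z∘ρ)) = sgn(re σ_w(α_{ρ_w⁻¹(1)}))·η_w(diag α)` whenever `q_w ≠ 0`** — the sign of the form on the coordinate line `ρ_w⁻¹(1)` carrying `u`, times the
majority sign; CONSTANT in `z`, any signature, any relabelling (`tr(Pᴴ σ_w(diag α) P) = |q_w|² σ_w(α_{ρ_w⁻¹(1)})`). [cite: Rogawski1990, §14.6 p. 242] [cite: LanglandsShelstad1987, §2, Lemma 4.1.A] -/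
theorem archKappaAt_cayleyTorus_relabel_eq_of_ne_zero (z : {w : InfinitePlace L // IsComplex w} → Fin 3 → Circle)
    (ρ : {w : InfinitePlace L // IsComplex w} → Perm (Fin 3)) (w : {w : InfinitePlace L // IsComplex w})
    (hq : ((z w 1 : ℂ) - (z w 0 : ℂ)) * ((z w 1 : ℂ) - (z w 2 : ℂ)) ≠ 0) :
    archKappaAt L (Matrix.diagonal α) (γH z) w (UnitaryGroup.archDiagTorus L 3 α fun w => z w ∘ ρ w) =
      (SignType.sign ((w.1.embedding (α ((ρ w).symm 1))).re) : ℤ) * archMajoritySign L (Matrix.diagonal α) w := by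
  unfold archKappaAt
  rw [archEigenlineProjector_cayleyTorus_relabel L α γH hγH z ρ w]
  set q : ℂ := ((z w 1 : ℂ) - (z w 0 : ℂ)) * ((z w 1 : ℂ) - (z w 2 : ℂ)) with hqdef
  rw [Matrix.diagonal_map (map_zero _), Matrix.diagonal_conjTranspose, Matrix.diagonal_mul_diagonal, Matrix.diagonal_mul_diagonal, Matrix.trace_diagonal]
  congr 2
  rw [Finset.sum_eq_single ((ρ w).symm 1)]
  · simp only [Pi.star_apply, Equiv.apply_symm_apply, if_true]
    have h : star q * w.1.embedding (α ((ρ w).symm 1)) * q = w.1.embedding (α ((ρ w).symm 1)) * (Complex.normSq q : ℂ) := by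
      rw [Complex.star_def, ← Complex.mul_conj]
      ring
    rw [h, mul_comm, Complex.re_ofReal_mul, sign_normSq_mul'' hq]
  · intro i _ hi
    have hne : ρ w i ≠ 1 := fun h => hi (by rw [← h, Equiv.symm_apply_apply])
    simp only [Pi.star_apply, hne, if_false, star_zero, zero_mul]
  · intro h; exact absurd (Finset.mem_univ _) h

include hγH in
/-- **(κ-TABLE) AT THE `G`-WALLS: `κ_w(γ_H(z), t(z∘ρ)) = 0` when `q_w = 0`** (the eigenline polynomial vanishes identically, `sgn 0 = 0`) — harmless: `D_{G∕H,∞} = 0` there too.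
[cite: Rogawski1990, §14.6 p. 242] -/
theorem archKappaAt_cayleyTorus_relabel_eq_zero (z : {w : InfinitePlace L // IsComplex w} → Fin 3 → Circle)
    (ρ : {w : InfinitePlace L // IsComplex w} → Perm (Fin 3)) (w : {w : InfinitePlace L // IsComplex w})
    (hq : ((z w 1 : ℂ) - (z w 0 : ℂ)) * ((z w 1 : ℂ) - (z w 2 : ℂ)) = 0) :
    archKappaAt L (Matrix.diagonal α) (γH z) w (UnitaryGroup.archDiagTorus L 3 α fun w => z w ∘ ρ w) = 0 := by
  unfold archKappaAt
  rw [archEigenlineProjector_cayleyTorus_relabel L α γH hγH z ρ w, hq]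
  have h0 : (Matrix.diagonal fun i : Fin 3 => if ρ w i = 1 then (0 : ℂ) else 0) = 0 := by
    ext i j; simp [Matrix.diagonal_apply]
  rw [h0, Matrix.mul_zero, Matrix.trace_zero, Complex.zero_re, sign_zero, SignType.coe_zero, zero_mul]

/-! ## §3 `D_{G∕H,∞}`, and `Δ″ = K_ρ · τ · D` on the whole family -/

include hγH in
open scoped Classical in
/-- **`D_{G∕H,∞}(γ_H(z)) = Π_w ‖q_w‖`**, `q_w = (z₁ − z₀)(z₁ − z₂)` (★ `archWeylRatio` = `Π_w ‖σ_w(χ_g(γ₂))‖`). [cite: Rogawski1990, §4.9 p. 55] -/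
theorem archWeylRatio_cayleyTorus (z : {w : InfinitePlace L // IsComplex w} → Fin 3 → Circle) :
    archWeylRatio L (γH z) = ∏ w : {w : InfinitePlace L // IsComplex w}, ‖((z w 1 : ℂ) - (z w 0 : ℂ)) * ((z w 1 : ℂ) - (z w 2 : ℂ))‖ := by
  unfold archWeylRatio
  exact Finset.prod_congr rfl fun w _ => by rw [evalC_eval_archCharpolyTwo_cayleyTorus L γH hγH z w]

include hγH in
open scoped Classical in
/-- **`Δ″(γ_H(z), t(z∘ρ)) = K_ρ · τ(γ_H(z)) · D_{G∕H,∞}(γ_H(z))` FOR ALL `z`**, `K_ρ := Π_w sgn(re σ_w(α_{ρ_w⁻¹(1)}))·η_w` (a constant in `{0, ±1}`): the pair matches (★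
`isArchNormPair_cayleyTorus_relabel`), so `Δ″ = τ·D·Π_w κ_w` (★ `archExplicitDelta_of_isArchNormPair`); off the walls `Π κ_w = K_ρ` (§2), at a wall `D = 0` kills both sides.
[cite: Rogawski1990, §4.9 p. 55; §14.6 p. 242] -/
theorem archExplicitDelta_cayleyTorus_relabel_eq_mul (z : {w : InfinitePlace L // IsComplex w} → Fin 3 → Circle)
    (ρ : {w : InfinitePlace L // IsComplex w} → Perm (Fin 3)) :
    archExplicitDelta L (Matrix.diagonal α) (γH z) μ (UnitaryGroup.archDiagTorus L 3 α fun w => z w ∘ ρ w) =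
      ((∏ w : {w : InfinitePlace L // IsComplex w}, ((SignType.sign ((w.1.embedding (α ((ρ w).symm 1))).re) : ℤ) * archMajoritySign L (Matrix.diagonal α) w) : ℤ) : ℂ) *
        (archTau L (γH z) μ * (archWeylRatio L (γH z) : ℂ)) := by
  rw [archExplicitDelta_of_isArchNormPair L (Matrix.diagonal α) (γH z) μ (isArchNormPair_cayleyTorus_relabel L α γH hγH z ρ)]
  by_cases hall : ∀ w : {w : InfinitePlace L // IsComplex w}, ((z w 1 : ℂ) - (z w 0 : ℂ)) * ((z w 1 : ℂ) - (z w 2 : ℂ)) ≠ 0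
  · rw [Finset.prod_congr rfl fun w _ => archKappaAt_cayleyTorus_relabel_eq_of_ne_zero L α γH hγH z ρ w (hall w)]
    ring
  · push Not at hall
    obtain ⟨w₀, hw₀⟩ := hall
    have hD : archWeylRatio L (γH z) = 0 := by
      rw [archWeylRatio_cayleyTorus L γH hγH z]
      exact Finset.prod_eq_zero (Finset.mem_univ w₀) (by rw [hw₀, norm_zero])
    simp only [hD, Complex.ofReal_zero, mul_zero, zero_mul]

/-! ## §4 Under the μ-guard: `τ·D` and `Δ″` are Laurent polynomials in the circle coordinates -/

include hγH in
open scoped Classical in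
/-- **`τ·D_{G∕H,∞}` ALONG THE FAMILY IS A LAURENT POLYNOMIAL UNDER THE μ-GUARD** (Rogawski p. 119: «`τ(γ)|A₁A₂| = μ(e^{iφ})e^{2i(φ−θ)t}(e^{i(φ−θ−ψ)} − 1)(1 − e^{i(φ−θ+ψ)})` … This is
smooth»): with the odd exponents `2k_w + 1` of ★ `exists_odd_archHeckeValue_single_eq_zpow`, for ALL `z`,
`τ(γ_H(z))·D_{G∕H,∞}(γ_H(z)) = Π_w [−(z_{w,0}z_{w,2})^{k_w}·(z_{w,1} − z_{w,0})(z_{w,1} − z_{w,2})∕z_{w,1}]` (at a `G`-wall both sides vanish: `μ_∞` of a non-unit is `0`).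
[cite: Rogawski1990, §8.2 p. 119; §4.9 p. 55] -/
theorem exists_archTau_mul_archWeylRatio_cayleyTorus_eq
    (hμω : ∀ x : ideleGroup ↥(maximalRealSubfield L), μ (AdeleRing.ideleBaseChange (↥(maximalRealSubfield L)) L x) = quadraticHeckeCharCM L x) :
    ∃ k : {w : InfinitePlace L // IsComplex w} → ℤ, ∀ z : {w : InfinitePlace L // IsComplex w} → Fin 3 → Circle,
      archTau L (γH z) μ * (archWeylRatio L (γH z) : ℂ) =
        ∏ w : {w : InfinitePlace L // IsComplex w},
          -((((z w 0 : ℂ) * (z w 2 : ℂ)) ^ (k w)) * (((z w 1 : ℂ) - (z w 0 : ℂ)) * ((z w 1 : ℂ) - (z w 2 : ℂ))) / (z w 1 : ℂ)) := by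
  -- the odd exponents of the place factors
  choose m hmodd hm using fun w : {w : InfinitePlace L // IsComplex w} => exists_odd_archHeckeValue_single_eq_zpow L μ w hμω
  choose k hk using fun w => hmodd w
  refine ⟨k, fun z => ?_⟩
  haveI : IsEmpty {w : InfinitePlace L // IsReal w} := ⟨fun v => (not_isReal_iff_isComplex.2 (IsTotallyComplex.isComplex v.1)) v.2⟩
  -- the readings
  have hγ₂ : ∀ w, (archGammaTwo L (γH z)).2 w = (z w 1 : ℂ) := fun w => by
    rw [← UnitaryGroup.evalC_apply]; exact evalC_archGammaTwo_cayleyTorus L γH hγH z w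
  have hA : ∀ w, (archTauArg L (γH z)).2 w = -((((z w 1 : ℂ) - (z w 0 : ℂ)) * ((z w 1 : ℂ) - (z w 2 : ℂ))) * ((z w 0 : ℂ) * (z w 2 : ℂ))⁻¹) := fun w => by
    rw [← UnitaryGroup.evalC_apply]; exact evalC_archTauArg_cayleyTorus L γH hγH z w
  unfold archTau
  rw [archWeylRatio_cayleyTorus L γH hγH z, archHeckeValue_eq_prod_single L μ (isUnit_archGammaTwo L (γH z))]
  simp_rw [hγ₂]
  by_cases hall : ∀ w : {w : InfinitePlace L // IsComplex w}, ((z w 1 : ℂ) - (z w 0 : ℂ)) * ((z w 1 : ℂ) - (z w 2 : ℂ)) ≠ 0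
  · -- all `A_w ≠ 0`: `A` is a unit and `μ_∞(A) = Π_w F_w(A_w)`
    have hAu : IsUnit (archTauArg L (γH z)) := by
      refine Prod.isUnit_iff.2 ⟨Pi.isUnit_iff.2 fun v => isEmptyElim v, Pi.isUnit_iff.2 fun w => ?_⟩
      rw [hA w, isUnit_iff_ne_zero, neg_ne_zero]
      exact mul_ne_zero (hall w) (inv_ne_zero (mul_ne_zero (Circle.coe_ne_zero _) (Circle.coe_ne_zero _)))
    rw [archHeckeValue_eq_prod_single L μ hAu]
    simp_rw [hA]
    rw [← Finset.prod_inv_distrib, ← Finset.prod_mul_distrib, Complex.ofReal_prod, ← Finset.prod_mul_distrib]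
    refine Finset.prod_congr rfl fun w _ => ?_
    rw [hm w _ (Circle.coe_ne_zero _), hm w _ (by
      rw [neg_ne_zero]; exact mul_ne_zero (hall w) (inv_ne_zero (mul_ne_zero (Circle.coe_ne_zero _) (Circle.coe_ne_zero _)))), hk w]
    exact circle_key (z w 0 : ℂ) (z w 1 : ℂ) (z w 2 : ℂ) (Circle.norm_coe _) (Circle.norm_coe _) (Circle.norm_coe _) (k w)
  · -- some `A_{w₀} = 0`: `A` is not a unit, `μ_∞(A) = 0`, both sides vanish
    push Not at hall
    obtain ⟨w₀, hw₀⟩ := hall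
    have hAnu : ¬ IsUnit (archTauArg L (γH z)) := by
      intro hu
      have h := (Pi.isUnit_iff.1 (Prod.isUnit_iff.1 hu).2) w₀
      rw [hA w₀, hw₀, zero_mul, neg_zero, isUnit_iff_ne_zero] at h
      exact h rfl
    rw [archHeckeValue_of_not_isUnit L μ hAnu, inv_zero, mul_zero, zero_mul]
    symm
    exact Finset.prod_eq_zero (Finset.mem_univ w₀) (by rw [hw₀, mul_zero, zero_div, neg_zero])

include hγH in
open scoped Classical in
/-- **(Δ-def-explicit) `Δ″` ON THE CAYLEY FAMILY IS A LAURENT POLYNOMIAL UNDER THE μ-GUARD**: there are integers `k_w` (from ★ `exists_odd_archHeckeValue_single_eq_zpow`) with, for ALL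
`z` and every relabelling `ρ`, `Δ″(γ_H(z), t(z∘ρ)) = K_ρ · Π_w [−(z_{w,0}z_{w,2})^{k_w}·(z_{w,1} − z_{w,0})(z_{w,1} − z_{w,2})∕z_{w,1}]`, `K_ρ = Π_w sgn(re σ_w(α_{ρ_w⁻¹(1)}))·η_w` — a
constant times a Laurent monomial times `q`, through every `G`-wall (§3 + the previous theorem). [cite: Rogawski1990, §8.2 p. 119; §4.9 p. 55; §14.6 p. 242] -/
theorem exists_archExplicitDelta_cayleyTorus_relabel_eq_prod
    (hμω : ∀ x : ideleGroup ↥(maximalRealSubfield L), μ (AdeleRing.ideleBaseChange (↥(maximalRealSubfield L)) L x) = quadraticHeckeCharCM L x) :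
    ∃ k : {w : InfinitePlace L // IsComplex w} → ℤ, ∀ (z : {w : InfinitePlace L // IsComplex w} → Fin 3 → Circle)
      (ρ : {w : InfinitePlace L // IsComplex w} → Perm (Fin 3)),
      archExplicitDelta L (Matrix.diagonal α) (γH z) μ (UnitaryGroup.archDiagTorus L 3 α fun w => z w ∘ ρ w) =
        ((∏ w : {w : InfinitePlace L // IsComplex w}, ((SignType.sign ((w.1.embedding (α ((ρ w).symm 1))).re) : ℤ) * archMajoritySign L (Matrix.diagonal α) w) : ℤ) : ℂ) *
          ∏ w : {w : InfinitePlace L // IsComplex w},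
            -((((z w 0 : ℂ) * (z w 2 : ℂ)) ^ (k w)) * (((z w 1 : ℂ) - (z w 0 : ℂ)) * ((z w 1 : ℂ) - (z w 2 : ℂ))) / (z w 1 : ℂ)) := by
  obtain ⟨k, hk⟩ := exists_archTau_mul_archWeylRatio_cayleyTorus_eq L γH hγH μ hμω
  exact ⟨k, fun z ρ => by rw [archExplicitDelta_cayleyTorus_relabel_eq_mul L α γH hγH μ z ρ, hk z]⟩

end CayleyTorus

end Literature.NumberTheory.Rogawski1990

end
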